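import Mathlib
import Summits.AtomisticToContinuum.Crystallization.Theses.LaminarSixThreeThree

/-!
# `BarlowToHcpWindows` — counting glue of route LaminarSixThreeThree

Item stmt-AtomisticToContinuum-14299 (support). If the fraction of particles whose `R`-window is
not Barlow-matched tends to `0` (`LaminarBarlowWindows`) and the fraction of particles whose window
is Barlow-matched but not hcp-matched tends to `0` (`StackingFaultSparsity`), then eventually in `N`
some particle has an hcp-matched window: the two bad fractions sum to something eventually `< 1`,
while if no particle were hcp-matched every particle would lie in one of the two bad sets.
-/

namespace Summit.AtomisticToContinuum.Crystallization.Theorems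

open Filter

/-- Abstract counting glue: for predicates `P Q` on the particles of the `N`-th configuration, if the
fraction of particles failing `P` and the fraction of particles satisfying `P` but failing `Q` both
tend to `0`, then eventually (in `N`) some particle satisfies `Q`. -/
theorem eventually_exists_of_card_div_tendsto_zero {P Q : (N : ℕ) → Fin N → Prop}
    (hP : Tendsto (fun N : ℕ => (Nat.card {i : Fin N // ¬ P N i} : ℝ) / N) atTop (nhds 0))
    (hQ : Tendsto (fun N : ℕ => (Nat.card {i : Fin N // P N i ∧ ¬ Q N i} : ℝ) / N) atTop
      (nhds 0)) :
    ∀ᶠ N in atTop, ∃ i : Fin N, Q N i := by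
  have hsum := hP.add hQ
  rw [add_zero] at hsum
  have hlt : ∀ᶠ N : ℕ in atTop, (Nat.card {i : Fin N // ¬ P N i} : ℝ) / N
      + (Nat.card {i : Fin N // P N i ∧ ¬ Q N i} : ℝ) / N < 1 :=
    hsum (Iio_mem_nhds one_pos)
  filter_upwards [hlt, eventually_ge_atTop 1] with N hN hN1
  by_contra hcon
  push Not at hcon
  classical
  -- every particle lies in one of the two bad sets
  have hcard : N ≤ Nat.card {i : Fin N // ¬ P N i} + Nat.card {i : Fin N // P N i ∧ ¬ Q N i} := by
    rw [Nat.card_eq_fintype_card, Nat.card_eq_fintype_card, Fintype.card_subtype,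
      Fintype.card_subtype]
    calc N = (Finset.univ : Finset (Fin N)).card := (Finset.card_fin N).symm
      _ ≤ (Finset.univ.filter (fun i : Fin N => ¬ P N i)
            ∪ Finset.univ.filter (fun i : Fin N => P N i ∧ ¬ Q N i)).card := by
          refine Finset.card_le_card ?_
          intro i _
          by_cases hPi : P N i
          · exact Finset.mem_union_right _ (Finset.mem_filter.2 ⟨Finset.mem_univ _, hPi, hcon i⟩)
          · exact Finset.mem_union_left _ (Finset.mem_filter.2 ⟨Finset.mem_univ _, hPi⟩)
      _ ≤ _ := Finset.card_union_le _ _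
  have hNpos : (0 : ℝ) < N := by exact_mod_cast hN1
  rw [← add_div, div_lt_one hNpos] at hN
  have hcard' : (N : ℝ) ≤ (Nat.card {i : Fin N // ¬ P N i} : ℝ)
      + (Nat.card {i : Fin N // P N i ∧ ¬ Q N i} : ℝ) := by exact_mod_cast hcard
  exact absurd hN (not_lt.2 hcard')

/-- **Item stmt-AtomisticToContinuum-14299** (`BarlowToHcpWindows`, support of route
LaminarSixThreeThree): `LaminarBarlowWindows` and `StackingFaultSparsity` give, for all `R > 0`,
`ε ∈ (0, 1/4)` and every ground-state sequence, eventually in `N` a particle whose `R`-window is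
`ε`-matched to `hcpStacking a h` for some `a, h ∈ (1/2, 2)`. Pure counting
(`eventually_exists_of_card_div_tendsto_zero`). -/
theorem barlowToHcpWindows_proof :
    Summit.AtomisticToContinuum.Crystallization.Theses.LaminarSixThreeThree.BarlowToHcpWindows := by
  unfold Summit.AtomisticToContinuum.Crystallization.Theses.LaminarSixThreeThree.BarlowToHcpWindows
  intro hX hS R ε hR hε hε' x hx
  exact eventually_exists_of_card_div_tendsto_zero (hX R ε hR hε hε' x hx) (hS R ε hR hε hε' x hx)

end Summit.AtomisticToContinuum.Crystallization.Theorems
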